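import Summits.CriticalPhenomena.PercolationContinuityZ3.Theorems.PercNearOneGluingNoHeavyQuantLawDecFlowsDecomposition
import Summits.CriticalPhenomena.PercolationContinuityZ3.Theorems.PercNearOneGluingNoHeavyQuantFlowUncross
import HarnessLib

/-!
# QUANT lane R8, T-DEC: DEC at an explicit target is MONOTONE UNDER UPGRADING ABSORBER MASS — moving mass from a mid `h` to a higher mid
# `h′ ≤ j′` preserves `DECAtT` (the reduction of the `h′ > h` case of `LawDec.SliceLawSW` to `h′ = h`)

builds on p205010 (kernel theorem, internal audit signed; external expert review pending)

Support file (`--supports stmt-CriticalPhenomena-4575`), QUANT lane seat prim-quant-census-2 (gen 55), rung R8 of `run/shared/lean/prim/quant/LADDER.md`.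
Memo `run/shared/lean/prim/quant/prim-quant-census-2-g55/SINGLE-LAYER-G55.md` §3c.  Theorems only, standard axioms, no sorries.

THE LEMMA.  Let `μ` be a law on `{0..M}` (vanishing above `M`, mass `1`) that is DEC(j′) at target `T`, floor `0 < x < 1` (`LawDec.DECAtT`).  Let `h < h′ ≤ j′`,
`h′ ≤ M`, with `h` a mid (`T ≤ 2h`), and `0 ≤ m ≤ μ h`.  Then the law `μ − m·δ_h + m·δ_{h′}` is again DEC(j′) at target `T`.  Proof in the flow normal form
(`flowAtT_of_decAtT` / `decAtT_of_flowAtT`, typer g22): redirect the fraction `θ = m/μ h` of every flow into `h` to `h′` — compatibility is inherited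
(`T < l + h < l + h′`) and the usage rate drops (`usage_anti_mid`, lead g21), so no absorber is overloaded.  Used by the proof plan of `LawDec.SliceLawSW`
(census-2 g55, `…QuantSliceSingleLayerLaws`): the transferred slice law with the transfer sent to a higher window position `h′ > h` is the `h′ = h` law with
mid mass moved up.  Checked exactly on 22 603 boundary laws (code/midup.py), 0 failures.

* `LawDec.sum_move_indicator` — mass bookkeeping;  `LawDec.flowAtT_move_mid_up` — the flow-form statement;  **`LawDec.decAtT_move_mid_up`** — the DEC statement.

[this work]; flow normal form and `usage_anti_mid` (this lane).  The gluing rows served [cite: KozmaNitzan2024, Conjecture 3 (p. 15)]; product measure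
[cite: Grimmett1999, §1.3 p. 10].
-/

noncomputable section

namespace Summit.CriticalPhenomena.PercolationContinuityZ3.Theorems

namespace Quant

open Finset

namespace LawDec

/-- mass bookkeeping: moving `m` from `h ≤ M` to `h′ ≤ M` does not change the total mass on `{0..M}`. [folklore] -/
theorem sum_move_indicator (μ : ℕ → ℝ) (M h h' : ℕ) (m : ℝ) (hh : h ≤ M) (hh' : h' ≤ M) :
    ∑ k ∈ Finset.range (M + 1), (μ k + (if k = h' then m else 0) - (if k = h then m else 0))
      = ∑ k ∈ Finset.range (M + 1), μ k := by
  rw [Finset.sum_sub_distrib, Finset.sum_add_distrib, Finset.sum_ite_eq' (Finset.range (M + 1)) h',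
    Finset.sum_ite_eq' (Finset.range (M + 1)) h, if_pos (Finset.mem_range.2 (by omega)), if_pos (Finset.mem_range.2 (by omega))]
  ring

/-- **upgrading absorber mass preserves the flow form**: `FlowAtT` for `μ` ⟹ `FlowAtT` for `μ − m·δ_h + m·δ_{h′}` when `h < h′ ≤ j′`, `h′ ≤ M`, `T ≤ 2h`,
`0 ≤ m ≤ μ h`, `0 < x < 1` (redirect the fraction `m/μ h` of every flow into `h` to `h′`; `usage_anti_mid`). [this work] -/
theorem flowAtT_move_mid_up (x T : ℝ) (j' M h h' : ℕ) (μ : ℕ → ℝ) (m : ℝ) (hx0 : 0 < x) (hx1 : x < 1)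
    (hhh' : h < h') (hh'j : h' ≤ j') (hh'M : h' ≤ M) (hT : T ≤ 2 * (h : ℝ)) (hm0 : 0 ≤ m) (hmh : m ≤ μ h)
    (hf : FlowAtT x T j' M μ) :
    FlowAtT x T j' M (fun k => μ k + (if k = h' then m else 0) - (if k = h then m else 0)) := by
  classical
  obtain ⟨f, hf0, hsupp, hlow, hcap⟩ := hf
  have hhM : h ≤ M := by omega
  have hne : h' ≠ h := by omega
  by_cases hμh : μ h = 0
  · -- then m = 0 and nothing changes
    have hm : m = 0 := le_antisymm (by rw [hμh] at hmh; exact hmh) hm0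
    refine ⟨f, hf0, hsupp, fun l hl h2 => ?_, fun k hk hnl => ?_⟩
    · rw [hlow l hl h2, hm]; simp
    · rw [hm]; simp only [ite_self, add_zero, sub_zero]; exact hcap k hk hnl
  have hμh_pos : 0 < μ h := lt_of_le_of_ne (hm0.trans hmh) (Ne.symm hμh)
  set θ : ℝ := m / μ h with hθ
  have hθ0 : 0 ≤ θ := div_nonneg hm0 hμh_pos.le
  have hθ1 : θ ≤ 1 := by rw [hθ, div_le_one hμh_pos]; exact hmh
  have hθμ : θ * μ h = m := by rw [hθ]; field_simp
  -- facts about a used pair into h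
  have used : ∀ l, 0 < f l h → l ≤ j' ∧ 2 * (l : ℝ) < T ∧ T < (l : ℝ) + h := by
    intro l hl
    obtain ⟨hlj, hl2, _, hc⟩ := hsupp l h hl
    refine ⟨hlj, hl2, ?_⟩
    rcases hc with hc | hc
    · exfalso; omega
    · exact hc
  -- the redirected flows
  let f' : ℕ → ℕ → ℝ := fun l k => if k = h then (1 - θ) * f l h else if k = h' then f l h' + θ * f l h else f l k
  have f'_eq : ∀ l k, f' l k = f l k + θ * f l h * ((if k = h' then (1 : ℝ) else 0) - (if k = h then (1 : ℝ) else 0)) := by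
    intro l k
    by_cases hk : k = h
    · have hkh' : ¬ (k = h') := fun e => hne (e.symm.trans hk)
      simp only [f']
      rw [if_pos hk, if_neg hkh', if_pos hk, hk]; ring
    · by_cases hk' : k = h'
      · simp only [f']
        rw [if_neg hk, if_pos hk', if_pos hk', if_neg hk, hk']; ring
      · simp only [f']
        rw [if_neg hk, if_neg hk', if_neg hk', if_neg hk]; ring
  refine ⟨f', ?_, ?_, ?_, ?_⟩
  · -- nonnegativity
    intro l k
    simp only [f']
    split_ifs
    · exact mul_nonneg (by linarith) (hf0 l h)
    · exact add_nonneg (hf0 l h') (mul_nonneg hθ0 (hf0 l h))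
    · exact hf0 l k
  · -- support
    intro l k hpos
    simp only [f'] at hpos
    by_cases hk : k = h
    · rw [if_pos hk] at hpos
      have hflh : 0 < f l h := by
        by_contra hle
        have : f l h = 0 := le_antisymm (not_lt.1 hle) (hf0 l h)
        rw [this, mul_zero] at hpos; exact lt_irrefl _ hpos
      rw [hk]; exact hsupp l h hflh
    · rw [if_neg hk] at hpos
      by_cases hk' : k = h'
      · rw [if_pos hk'] at hpos
        rw [hk']
        by_cases hflh' : 0 < f l h'
        · exact hsupp l h' hflh'
        · have hz : f l h' = 0 := le_antisymm (not_lt.1 hflh') (hf0 l h')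
          rw [hz, zero_add] at hpos
          have hflh : 0 < f l h := by
            by_contra hle
            have : f l h = 0 := le_antisymm (not_lt.1 hle) (hf0 l h)
            rw [this, mul_zero] at hpos; exact lt_irrefl _ hpos
          obtain ⟨hlj, hl2, hc⟩ := used l hflh
          have hh'r : (h : ℝ) < h' := by exact_mod_cast hhh'
          exact ⟨hlj, hl2, hh'M, Or.inr (by linarith)⟩
      · rw [if_neg hk'] at hpos
        exact hsupp l k hpos
  · -- every low atom is shipped exactly (lows are neither h nor h′)
    intro l hlj hl2
    dsimp only
    have hlh : l ≠ h := by
      intro e; rw [e] at hl2; linarith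
    have hlh' : l ≠ h' := by
      intro e; rw [e] at hl2
      have : (h : ℝ) < h' := by exact_mod_cast hhh'
      linarith
    rw [if_neg hlh', if_neg hlh, add_zero, sub_zero]
    rw [Finset.sum_congr rfl (fun k _ => f'_eq l k), Finset.sum_add_distrib, hlow l hlj hl2, ← Finset.mul_sum, Finset.sum_sub_distrib,
      Finset.sum_ite_eq' (Finset.range (M + 1)) h', Finset.sum_ite_eq' (Finset.range (M + 1)) h,
      if_pos (Finset.mem_range.2 (by omega)), if_pos (Finset.mem_range.2 (by omega))]
    ring
  · -- no absorber is overloaded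
    intro k hkM hnl
    dsimp only
    by_cases hk : k = h
    · -- position h keeps the fraction (1 − θ)
      have hkh' : ¬ (k = h') := fun e => hne (e.symm.trans hk)
      rw [if_neg hkh', if_pos hk, add_zero]
      have e : ∀ l ∈ Finset.range (j' + 1), usage x T j' l k * f' l k = (1 - θ) * (usage x T j' l k * f l k) := by
        intro l _; simp only [f']; rw [if_pos hk, hk]; ring
      rw [Finset.sum_congr rfl e, ← Finset.mul_sum]
      have hc := hcap k hkM hnl
      have h1θ : 0 ≤ 1 - θ := by linarith
      rw [hk] at hc ⊢
      calc (1 - θ) * ∑ l ∈ Finset.range (j' + 1), usage x T j' l h * f l h ≤ (1 - θ) * μ h :=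
            mul_le_mul_of_nonneg_left hc h1θ
        _ = μ h - m := by rw [← hθμ]; ring
    · by_cases hk' : k = h'
      · -- position h′ receives the redirected flows at a lower rate
        rw [if_pos hk', if_neg hk]
        have e : ∀ l ∈ Finset.range (j' + 1), usage x T j' l k * f' l k
            = usage x T j' l k * f l k + θ * (usage x T j' l k * f l h) := by
          intro l _; simp only [f']; rw [if_neg hk, if_pos hk', hk']; ring
        rw [Finset.sum_congr rfl e, Finset.sum_add_distrib, ← Finset.mul_sum]
        have hc := hcap k hkM hnl
        have hch := hcap h hhM (Or.inr hT)
        -- termwise: usage(l,h′)·f l h ≤ usage(l,h)·f l h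
        have hterm : ∀ l ∈ Finset.range (j' + 1), usage x T j' l k * f l h ≤ usage x T j' l h * f l h := by
          intro l _
          rcases (hf0 l h).eq_or_lt with hz | hpos
          · rw [← hz, mul_zero, mul_zero]
          · obtain ⟨_, hl2, hcomp⟩ := used l hpos
            rw [hk']
            exact mul_le_mul_of_nonneg_right (usage_anti_mid x T j' l h h' hx0 hx1 hhh' hh'j hl2 hcomp) hpos.le
        have hsum : ∑ l ∈ Finset.range (j' + 1), usage x T j' l k * f l h ≤ μ h :=
          (Finset.sum_le_sum hterm).trans hch
        have := mul_le_mul_of_nonneg_left hsum hθ0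
        rw [hθμ] at this
        rw [hk'] at hc ⊢
        rw [hk'] at this
        linarith
      · -- any other position is untouched
        rw [if_neg hk', if_neg hk, add_zero, sub_zero]
        have e : ∀ l ∈ Finset.range (j' + 1), usage x T j' l k * f' l k = usage x T j' l k * f l k := by
          intro l _; simp only [f']; rw [if_neg hk, if_neg hk']
        rw [Finset.sum_congr rfl e]
        exact hcap k hkM hnl

/-- **DEC AT AN EXPLICIT TARGET IS MONOTONE UNDER UPGRADING ABSORBER MASS.**  For a law `μ` on `{0..M}` (vanishing above `M`, mass `1`) that is DEC(j′)
at target `T` (floor `0 < x < 1`), a mid `h` (`T ≤ 2h`), a higher mid `h < h′ ≤ j′`, `h′ ≤ M`, and `0 ≤ m ≤ μ h`: the law `μ − m·δ_h + m·δ_{h′}` is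
DEC(j′) at target `T`. [this work] -/
theorem decAtT_move_mid_up (x T : ℝ) (j' M h h' : ℕ) (μ : ℕ → ℝ) (m : ℝ) (hx0 : 0 < x) (hx1 : x < 1)
    (hμM : ∀ k, M < k → μ k = 0) (hμ1 : ∑ k ∈ Finset.range (M + 1), μ k = 1)
    (hhh' : h < h') (hh'j : h' ≤ j') (hh'M : h' ≤ M) (hT : T ≤ 2 * (h : ℝ)) (hm0 : 0 ≤ m) (hmh : m ≤ μ h)
    (hdec : DECAtT x T j' M μ) :
    DECAtT x T j' M (fun k => μ k + (if k = h' then m else 0) - (if k = h then m else 0)) := by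
  have hf := flowAtT_of_decAtT x T j' M μ hx0 hx1 hdec
  have hf' := flowAtT_move_mid_up x T j' M h h' μ m hx0 hx1 hhh' hh'j hh'M hT hm0 hmh hf
  refine decAtT_of_flowAtT x T j' M _ hx0 hx1 (fun k hk => ?_) ?_ hf'
  · rw [hμM k hk, if_neg (by omega), if_neg (by omega)]; ring
  · rw [sum_move_indicator μ M h h' m (by omega) hh'M, hμ1]

end LawDec

end Quant

end Summit.CriticalPhenomena.PercolationContinuityZ3.Theorems
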